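import Literature.Algebra.Homology.CharpolyHomologyShortComplex
import Literature.Algebra.Homology.CharpolyEulerPoincare
import Literature.Algebra.Homology.TraceHomologySequence
import HarnessLib

/-!
# Characteristic polynomials along the long exact homology sequence with an endomorphism (LEAF 1 of 2)

Layer `Literature/Algebra/Homology` (pure linear algebra over Mathlib; proved theorems only, 0 definitions, 0 named facts, no instances,
no notation). Row `TraceHomologySequence` splits the TRACE of each term of the long exact homology sequence of a short exact sequence
`S : 0 → X₁ → X₂ → X₃ → 0` of complexes carrying an endomorphism `τ : S ⟶ S`; this file is its CHARACTERISTIC-POLYNOMIAL twin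
(Bourbaki, *Algèbre* VIII §20 n°6: `χ` is multiplicative in exact sequences; Lang XX §3: `χ` is an Euler–Poincaré map):

* `charpoly_τ₂_eq_of_exact` — exact `X₁ → X₂ → X₃` with an endomorphism, `X₂` finite-dimensional: `χ(τ₂) = χ(τ₃ | range g) · χ(τ₂ | range f)`
  (row `CharpolyHomologyShortComplex`'s `charpoly_τ₂_eq` with `H = 0` via row `CharpolyEulerPoincare`'s `charpoly_eq_one_of_subsingleton`);
* **`charpoly_homologyMap_τ₂_eq`**, **`charpoly_homologyMap_τ₃_eq_of_rel`**, **`charpoly_homologyMap_τ₁_eq_of_rel`** — each term of the long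
  exact sequence (Mathlib `hS.homology_exact₂/₃/₁`) splits its characteristic polynomial over the images of the two adjacent maps, the
  endomorphism of the sequence being assembled from row `TraceHomologySequence`'s commutation lemmas (BY NAME);
* boundary degrees: `charpoly_restrict_range_eq_of_surjective` / `_of_injective` and their homology readings
  `charpoly_restrict_range_homologyMap_g_eq` (no successor of `i`) / `charpoly_restrict_range_homologyMap_f_eq` (no predecessor of `j`).

Rows `TraceHomologySequence` / `LefschetzNumberHomologyShortExact` are the `nextCoeff` shadows and are NOT restated or re-derived. LEAF 2
(`CharpolyHomologyShortExact`) multiplies these identities with signs. Library only (cell `pub-hodge-ring2`, count-neutral).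

## References

* N. Bourbaki, *Algèbre, Chapitre VIII* (2012), §20 n°6, p. 377. [BourbakiAlgebreVIII2012]
* S. Lang, *Algebra* (2002), Ch. XX §3 (Euler–Poincaré maps). [Lang2002]
* E. H. Spanier, *Algebraic Topology* (1981), Ch. 4 §7 (exact sequences with an endomorphism). [Spanier1981]
-/

open CategoryTheory CategoryTheory.Limits

universe v u w

namespace Literature.Algebra.Homology.HopfTrace

variable {K : Type u} [Field K]

/-! ### One exact piece -/

/-- **`χ(τ₂) = χ(τ₃ | range g) · χ(τ₂ | range f)`** along an exact `X₁ → X₂ → X₃` with an endomorphism (`X₂` finite-dimensional).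
[cite: BourbakiAlgebreVIII2012, VIII §20 n°6 (p. 377)] -/
theorem charpoly_τ₂_eq_of_exact {T : ShortComplex (ModuleCat.{v} K)} (hT : T.Exact) (ψ : T ⟶ T) [Module.Finite K T.X₂] :
    ψ.τ₂.hom.charpoly = (ψ.τ₃.hom.restrict (mapsTo_range_g T ψ)).charpoly * (ψ.τ₂.hom.restrict (mapsTo_range_f T ψ)).charpoly := by
  haveI : Subsingleton T.homology := ModuleCat.subsingleton_of_isZero (T.exact_iff_isZero_homology.1 hT)
  haveI : Module.Finite K T.homology := moduleFinite_shortComplexHomology T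
  rw [charpoly_τ₂_eq T ψ, charpoly_eq_one_of_subsingleton, one_mul]

/-- If `g` is onto, `χ(τ₃ | range g) = χ(τ₃)`. [cite: BourbakiAlgebreVIII2012, VIII §20 n°6 (p. 377)] -/
theorem charpoly_restrict_range_eq_of_surjective {M N : Type v} [AddCommGroup M] [Module K M] [AddCommGroup N] [Module K N]
    [Module.Finite K N] (g : M →ₗ[K] N) (hg : Function.Surjective g) (u : N →ₗ[K] N)
    (hu : ∀ x ∈ LinearMap.range g, u x ∈ LinearMap.range g) : (u.restrict hu).charpoly = u.charpoly := by
  have htop : LinearMap.range g = ⊤ := LinearMap.range_eq_top.2 hg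
  let e : LinearMap.range g ≃ₗ[K] N := (LinearEquiv.ofEq _ _ htop).trans (LinearEquiv.ofTop ⊤ rfl)
  have he : e.conj (u.restrict hu) = u := LinearMap.ext fun x => by rw [LinearEquiv.conj_apply_apply]; rfl
  rw [← LinearEquiv.charpoly_conj e (u.restrict hu), he]

/-- If `f : M → N` is injective and intertwines `u₁` with `u₂`, `χ(u₂ | range f) = χ(u₁)`. [cite: BourbakiAlgebreVIII2012, VIII §20 n°6 (p. 377)] -/
theorem charpoly_restrict_range_eq_of_injective {M N : Type v} [AddCommGroup M] [Module K M] [AddCommGroup N] [Module K N]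
    [Module.Finite K M] [Module.Finite K N] (f : M →ₗ[K] N) (hf : Function.Injective f) (u₁ : M →ₗ[K] M) (u₂ : N →ₗ[K] N)
    (h : f ∘ₗ u₁ = u₂ ∘ₗ f) (hu : ∀ x ∈ LinearMap.range f, u₂ x ∈ LinearMap.range f) : (u₂.restrict hu).charpoly = u₁.charpoly := by
  let e : M ≃ₗ[K] LinearMap.range f := LinearEquiv.ofInjective f hf
  have he : e.conj u₁ = u₂.restrict hu := LinearMap.ext fun y => by
    obtain ⟨x, rfl⟩ := e.surjective y
    apply Subtype.ext
    rw [LinearEquiv.conj_apply_apply, LinearEquiv.symm_apply_apply, LinearMap.coe_restrict_apply, LinearEquiv.ofInjective_apply,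
      LinearEquiv.ofInjective_apply]
    exact congr($h x)
  rw [← he, LinearEquiv.charpoly_conj]

/-! ### Along the long exact homology sequence -/

variable {ι : Type w} {c : ComplexShape ι} {S : ShortComplex (HomologicalComplex (ModuleCat.{v} K) c)} (hS : S.ShortExact) (τ : S ⟶ S)
include hS

/-- **`χ(Hᵢ(τ₂)) = χ(Hᵢ(τ₃) | im Hg) · χ(Hᵢ(τ₂) | im Hf)`** (`Hᵢ(X₂)` finite-dimensional; exactness at `Hᵢ(X₂)`).
[cite: BourbakiAlgebreVIII2012, VIII §20 n°6 (p. 377)] [cite: Spanier1981, Ch. 4 §7] -/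
theorem charpoly_homologyMap_τ₂_eq (i : ι) [Module.Finite K (S.X₂.homology i)] :
    (HomologicalComplex.homologyMap τ.τ₂ i).hom.charpoly =
      ((HomologicalComplex.homologyMap τ.τ₃ i).hom.restrict (mapsTo_range_homologyMap_g τ i)).charpoly *
        ((HomologicalComplex.homologyMap τ.τ₂ i).hom.restrict (mapsTo_range_homologyMap_f τ i)).charpoly :=
  charpoly_τ₂_eq_of_exact (hS.homology_exact₂ i)
    (ShortComplex.homMk (HomologicalComplex.homologyMap τ.τ₁ i) (HomologicalComplex.homologyMap τ.τ₂ i)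
      (HomologicalComplex.homologyMap τ.τ₃ i) (homologyMap_τ₁_comp_f τ i) (homologyMap_τ₂_comp_g τ i))

/-- **`χ(Hᵢ(τ₃)) = χ(Hⱼ(τ₁) | im δ) · χ(Hᵢ(τ₃) | im Hg)`** across `c.Rel i j` (`Hᵢ(X₃)` finite-dimensional; exactness at `Hᵢ(X₃)`).
[cite: BourbakiAlgebreVIII2012, VIII §20 n°6 (p. 377)] [cite: Spanier1981, Ch. 4 §7] -/
theorem charpoly_homologyMap_τ₃_eq_of_rel (i j : ι) (hij : c.Rel i j) [Module.Finite K (S.X₃.homology i)] :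
    (HomologicalComplex.homologyMap τ.τ₃ i).hom.charpoly =
      ((HomologicalComplex.homologyMap τ.τ₁ j).hom.restrict (mapsTo_range_δ hS τ i j hij)).charpoly *
        ((HomologicalComplex.homologyMap τ.τ₃ i).hom.restrict (mapsTo_range_homologyMap_g τ i)).charpoly :=
  charpoly_τ₂_eq_of_exact (hS.homology_exact₃ i j hij)
    (ShortComplex.homMk (HomologicalComplex.homologyMap τ.τ₂ i) (HomologicalComplex.homologyMap τ.τ₃ i)
      (HomologicalComplex.homologyMap τ.τ₁ j) (homologyMap_τ₂_comp_g τ i) (homologyMap_τ₃_comp_δ hS τ i j hij))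

/-- **`χ(Hⱼ(τ₁)) = χ(Hⱼ(τ₂) | im Hf) · χ(Hⱼ(τ₁) | im δ)`** across `c.Rel i j` (`Hⱼ(X₁)` finite-dimensional; exactness at `Hⱼ(X₁)`).
[cite: BourbakiAlgebreVIII2012, VIII §20 n°6 (p. 377)] [cite: Spanier1981, Ch. 4 §7] -/
theorem charpoly_homologyMap_τ₁_eq_of_rel (i j : ι) (hij : c.Rel i j) [Module.Finite K (S.X₁.homology j)] :
    (HomologicalComplex.homologyMap τ.τ₁ j).hom.charpoly =
      ((HomologicalComplex.homologyMap τ.τ₂ j).hom.restrict (mapsTo_range_homologyMap_f τ j)).charpoly *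
        ((HomologicalComplex.homologyMap τ.τ₁ j).hom.restrict (mapsTo_range_δ hS τ i j hij)).charpoly :=
  charpoly_τ₂_eq_of_exact (hS.homology_exact₁ i j hij)
    (ShortComplex.homMk (HomologicalComplex.homologyMap τ.τ₃ i) (HomologicalComplex.homologyMap τ.τ₁ j)
      (HomologicalComplex.homologyMap τ.τ₂ j) (homologyMap_τ₃_comp_δ hS τ i j hij) (homologyMap_τ₁_comp_f τ j))

/-! ### Boundary degrees -/

/-- With no successor of `i`, `Hᵢ(g)` is onto and `χ(Hᵢ(τ₃) | im Hg) = χ(Hᵢ(τ₃))`. [cite: Spanier1981, Ch. 4 §7] -/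
theorem charpoly_restrict_range_homologyMap_g_eq (i : ι) (hi : ¬c.Rel i (c.next i)) [Module.Finite K (S.X₃.homology i)] :
    ((HomologicalComplex.homologyMap τ.τ₃ i).hom.restrict (mapsTo_range_homologyMap_g τ i)).charpoly =
      (HomologicalComplex.homologyMap τ.τ₃ i).hom.charpoly := by
  haveI := hS.epi_g
  haveI : Epi (HomologicalComplex.homologyMap S.g i) :=
    HomologicalComplex.epi_homologyMap_of_epi_of_not_rel S.g i fun j hj => hi (by rwa [c.next_eq' hj])
  exact charpoly_restrict_range_eq_of_surjective _ ((ModuleCat.epi_iff_surjective _).1 inferInstance) _ _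

/-- With no predecessor of `j`, `Hⱼ(f)` is injective and `χ(Hⱼ(τ₂) | im Hf) = χ(Hⱼ(τ₁))`. [cite: Spanier1981, Ch. 4 §7] -/
theorem charpoly_restrict_range_homologyMap_f_eq (j : ι) (hj : ¬c.Rel (c.prev j) j) [Module.Finite K (S.X₁.homology j)]
    [Module.Finite K (S.X₂.homology j)] :
    ((HomologicalComplex.homologyMap τ.τ₂ j).hom.restrict (mapsTo_range_homologyMap_f τ j)).charpoly =
      (HomologicalComplex.homologyMap τ.τ₁ j).hom.charpoly := by
  haveI := hS.mono_f
  haveI : Mono (HomologicalComplex.homologyMap S.f j) :=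
    HomologicalComplex.mono_homologyMap_of_mono_of_not_rel S.f j fun i hi => hj (by rwa [c.prev_eq' hi])
  refine charpoly_restrict_range_eq_of_injective _ ((ModuleCat.mono_iff_injective _).1 inferInstance) _ _ ?_ _
  have h := homologyMap_τ₁_comp_f τ j
  rw [← ModuleCat.hom_comp, ← ModuleCat.hom_comp, h]

end Literature.Algebra.Homology.HopfTrace
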